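import Mathlib
import Literature.NumberTheory.LFunctions.Zhang2022.AppendixBTailB3Termwise
import Literature.NumberTheory.LFunctions.Zhang2022.AppendixBVarrhoMeanValue
import HarnessLib

/-!
# Zhang (2022), Appendix B, proof of (B.3): the step `Z22:§B.u013` in the reading of record, discharged

Topic `Literature/NumberTheory/LFunctions/Zhang2022` (Landau–Siegel audit tree; verdict-neutral).
Y. Zhang, *Discrete mean estimates and the Landau–Siegel zero*, arXiv:2211.02515v1 (2022)
[Zhang2022LandauSiegel] — **an unrefereed manuscript under adjudication**; nothing here asserts or denies
its Theorems 1–2. Appendix B p. 108 (tex L5322, DAG `Z22:§B.u013`): "By (4.2) and (4.3), the left side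
of (B.3) is equal to `Σ_l ϱ_j(l)/l (P₁/(l₁l))^{β₆} (1/0.504)∫_{0.5}^{0.504} {g(P^z/(l₁l)) − g(P^{0.5}/(l₁l))} dz
+ O(α₁)`" — typed `Typed.AppendixB.StepB_u013R c′` (`‖tailB3 − seriesB13‖ ≤ C·α₁`, `α₁ = α log T`).

PROOF (`stepB_u013R_holds`; termwise comparison in `AppendixBTailB3Termwise`, weights in
`AppendixBTailB3Transition`/`AppendixBTailB3Weights`). For `y = l₁l` the `z`-average
`(1/0.504)∫_{0.5}^{0.504}(1[y < P^z] − 1[y < P^{1/2}])dz` IS the amplitude `(1 − log y/log P₁)1[P^{1/2} < y < P₁]`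
of `ϰ₁(y)` on the tail (`AppendixBTailB3Weights.integral_indicator_eq`); replacing the indicator by the
Gaussian weight `g` of (4.1) costs, termwise, `≤ ∫½e^{−Λ(z log P − log y)²}dz + 0.002e^{−Λ(log P/2 − log y)²}`
(`abs_weight_transition_le`, `Λ = 𝓛³⁰`). Three ranges of `l`: the window `P^{1/2}/(el₁) < l ≤ eP^{1/2}/l₁`
(both terms bounded by `|ϱ_j(l)|/l`, and `Σ_window |ϱ_j(l)|/l ≪ 1/log(P^{1/2}/l₁) ≪ α` by Hall–Tenenbaum,
`AppendixBVarrhoMeanValue.sum_norm_rho_div_window_le`); `l₁l < P` off the window (error `≪ 1/log P + e^{−Λ}`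
against `Σ_{l<P}|ϱ_j(l)|/l ≪ 1`, `AppendixBVarrho.sum_norm_rho_div_le`); and `l₁l ≥ P` (Gaussian decay
`≤ 0.004(l₁l)⁻²`, `gauss_transition_decay`, summed against `l^{−3/2}`). Total `≤ C·α ≤ C·α₁`.
No claim about Lemma 15.1, Theorems 1–2 of the source or about Landau–Siegel zeros is made.
-/

noncomputable section

open Complex Real Finset MeasureTheory Set

namespace Literature.NumberTheory.LFunctions.Zhang2022.AppendixBVarrho

open Literature.NumberTheory.LFunctions Literature.NumberTheory.LFunctions.Zhang2022 Skeleton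
  Typed.AppendixB GaussWeight MeanSquareMajorant

/-! ## Parameters of the source at `D ≥ 8` -/

/-- `𝓛 ≥ 2` for `D ≥ 8` (`e² < 8`). [cite: Zhang2022LandauSiegel, §2 (2.1)] -/
private theorem two_le_ell {D : ℕ} (hD : 8 ≤ D) : 2 ≤ ell D := by
  have h8 : (8 : ℝ) ≤ D := by exact_mod_cast hD
  have he : Real.exp 2 ≤ 8 := by
    have h1 := Real.exp_one_lt_d9
    have h0 := Real.exp_pos (1 : ℝ)
    rw [show (2 : ℝ) = 1 + 1 by norm_num, Real.exp_add]
    nlinarith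
  calc (2 : ℝ) = Real.log (Real.exp 2) := (Real.log_exp 2).symm
    _ ≤ Real.log 8 := Real.log_le_log (Real.exp_pos 2) he
    _ ≤ Real.log D := Real.log_le_log (by norm_num) h8
    _ = ell D := rfl

/-- `log 4 ≤ 2`. [folklore] -/
private theorem log_four_le_two : Real.log 4 ≤ 2 := by
  have h2 : Real.log 4 = 2 * Real.log 2 := by
    rw [show (4 : ℝ) = 2 ^ 2 by norm_num, Real.log_pow]; norm_num
  rw [h2]; linarith [Real.log_two_lt_d9]

/-- The exponential weight `e^{|v| log x}` of the `|ϱ_j|`-means is `O(1)`: `|v| ≤ 3πM/L`, `log x ≤ 3 + L`.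
[cite: Zhang2022LandauSiegel, App. B p.108 (proof of (B.3))] -/
private theorem exp_weight_le {v L M x : ℝ} (hv : |v| ≤ 3 * Real.pi * M / L) (hL1 : 1 ≤ L)
    (hM : 0 ≤ M) (hx0 : 0 ≤ Real.log x) (hx : Real.log x ≤ 3 + L) :
    Real.exp (|v| * Real.log x) ≤ Real.exp (12 * Real.pi * M) := by
  rw [Real.exp_le_exp]
  have hL0 : 0 < L := by linarith
  calc |v| * Real.log x ≤ (3 * Real.pi * M / L) * (3 + L) := mul_le_mul hv hx hx0 (by positivity)
    _ = 3 * Real.pi * M * (3 / L + 1) := by field_simp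
    _ ≤ 3 * Real.pi * M * 4 := by
        refine mul_le_mul_of_nonneg_left ?_ (by positivity)
        have : 3 / L ≤ 3 := by
          rw [div_le_iff₀ hL0]; nlinarith
        linarith
    _ = 12 * Real.pi * M := by ring

/-- The off-window transition constant is `≤ 3/L` (`Λ ≥ L > 0`).
[cite: Zhang2022LandauSiegel, App. B p.108 (proof of (B.3))] -/
private theorem cO_le {Λ L : ℝ} (hL0 : 0 < L) (hΛ1 : 1 ≤ Λ) (hΛL : L ≤ Λ) :
    (1 / 0.504) * ((1 / 2) * Real.sqrt (π / Λ) / L + 0.002 * rexp (-Λ)) ≤ 3 / L := by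
  have hΛ0 : 0 < Λ := by linarith
  have h1 : Real.sqrt (π / Λ) ≤ 2 := by
    rw [Real.sqrt_le_left (by norm_num), div_le_iff₀ hΛ0]
    have := Real.pi_lt_four
    nlinarith
  have h2 : rexp (-Λ) ≤ 1 / L := by
    have h3 : rexp (-Λ) ≤ 1 / Λ := by
      rw [Real.exp_neg, one_div]
      exact inv_anti₀ hΛ0 (by linarith [Real.add_one_le_exp Λ])
    exact le_trans h3 (one_div_le_one_div_of_le hL0 hΛL)
  have h4 : (1 / 2) * Real.sqrt (π / Λ) / L ≤ 1 / L :=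
    div_le_div_of_nonneg_right (by linarith) hL0.le
  calc (1 / 0.504) * ((1 / 2) * Real.sqrt (π / Λ) / L + 0.002 * rexp (-Λ))
      ≤ (1 / 0.504) * (1 / L + 0.002 * (1 / L)) := by gcongr
    _ = (1.002 / 0.504) * (1 / L) := by ring
    _ ≤ 3 * (1 / L) := mul_le_mul_of_nonneg_right (by norm_num) (by positivity)
    _ = 3 / L := by ring

/-- `P^{−1/2} ≤ 2/𝓛⁹` (`P = e^{𝓛⁹}`, `e^{−x/2} ≤ 2/x`). [cite: Zhang2022LandauSiegel, §2 (2.6)] -/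
private theorem bigP_rpow_neg_half_le {D : ℕ} {L : ℝ} (hL : L = ell D ^ 9) (hL0 : 0 < L) :
    bigP D ^ (-(1 / 2) : ℝ) ≤ 2 / L := by
  have h1 : bigP D ^ (-(1 / 2) : ℝ) = Real.exp (-(L / 2)) := by
    rw [bigP, ← Real.exp_mul, ← hL]
    congr 1; ring
  rw [h1, Real.exp_neg]
  have h2 : L / 2 ≤ Real.exp (L / 2) := by linarith [Real.add_one_le_exp (L / 2)]
  calc (Real.exp (L / 2))⁻¹ ≤ (L / 2)⁻¹ := inv_anti₀ (by positivity) h2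
    _ = 2 / L := by rw [inv_div]

/-- `log l₁ ≤ 𝓛⁹/4` for `l₁ < T = e^{𝓛^{1.1}}` and `𝓛 ≥ 2`. [cite: Zhang2022LandauSiegel, §6 p.12] -/
private theorem log_le_of_lt_bigT {D l₁ : ℕ} {L : ℝ} (hL : L = ell D ^ 9) (hℓ1 : 1 ≤ ell D)
    (hℓ2 : 2 ≤ ell D) (hl₁0 : (0 : ℝ) < l₁) (hT : (l₁ : ℝ) < bigT D) : Real.log l₁ ≤ L / 4 := by
  have h1 : Real.log l₁ < ell D ^ (1.1 : ℝ) := by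
    have := Real.log_lt_log hl₁0 hT
    rwa [bigT, Real.log_exp] at this
  have h2 : ell D ^ (1.1 : ℝ) ≤ ell D ^ 2 := by
    rw [← Real.rpow_two]
    exact Real.rpow_le_rpow_of_exponent_le hℓ1 (by norm_num)
  have h5 : (4 : ℝ) ≤ ell D ^ 7 := by
    calc (4 : ℝ) ≤ 2 ^ 7 := by norm_num
      _ ≤ ell D ^ 7 := pow_le_pow_left₀ (by norm_num) hℓ2 7
  have h6 : 0 ≤ ell D ^ 2 := by positivity
  have h4 : ell D ^ 2 * 4 ≤ L := by
    calc ell D ^ 2 * 4 ≤ ell D ^ 2 * ell D ^ 7 := mul_le_mul_of_nonneg_left h5 h6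
      _ = L := by rw [hL]; ring
  linarith

/-! ## `Z22:§B.u013` in the reading of record -/

set_option maxHeartbeats 400000 in
/-- **`Z22:§B.u013` holds in the reading of record `α₁ = α log T`**: for every `c′` there is `C` with
`‖tailB3 c′ D j l₁ − seriesB13 c′ D j l₁‖ ≤ C·α₁` for all large `D`, `j ∈ {1,2,3}`, `1 ≤ l₁ < T`
("By (4.2) and (4.3), the left side of (B.3) is equal to `Σ_l ϱ_j(l)/l (P₁/(l₁l))^{β₆}
(1/0.504)∫_{0.5}^{0.504}{g(P^z/(l₁l)) − g(P^{0.5}/(l₁l))}dz + O(α₁)`"; in fact `O(α)`).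
DAG `Z22:§B.u013` [Z22 p.108, tex L5322]. [cite: Zhang2022LandauSiegel, App. B p.108 (proof of (B.3))] -/
theorem stepB_u013R_holds (c' : ℝ) : StepB_u013R c' := by
  -- the constants
  obtain ⟨M₀, hM₀⟩ : ∃ M : ℝ, M = 1 + 5 * |c'| * Real.pi := ⟨_, rfl⟩
  obtain ⟨K, hK⟩ : ∃ K : ℝ, K = (2 * Real.log 4 + 2 * HallTenenbaum.B₁ + 1) * majorantConst 0 1 :=
    ⟨_, rfl⟩
  obtain ⟨E₀, hE₀⟩ : ∃ E : ℝ, E = Real.exp (12 * Real.pi * M₀) := ⟨_, rfl⟩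
  obtain ⟨S₃₂, hS₃₂⟩ : ∃ S : ℝ, S = ∑' l : ℕ, ((l : ℝ) ^ (3 / 2 : ℝ))⁻¹ := ⟨_, rfl⟩
  have hM₀1 : 1 ≤ M₀ := by
    have : 0 ≤ 5 * |c'| * Real.pi := by positivity
    linarith
  have hM₀0 : 0 ≤ M₀ := by linarith
  have hmc := majorantConst_pos 0 1
  have hKpos : 0 < K := by
    have h1 : 0 ≤ Real.log 4 := Real.log_nonneg (by norm_num)
    have h2 := HallTenenbaum.B₁_nonneg
    rw [hK]; positivity
  have hE₀pos : 0 < E₀ := by rw [hE₀]; exact Real.exp_pos _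
  have hS_sum : Summable fun l : ℕ => ((l : ℝ) ^ (3 / 2 : ℝ))⁻¹ :=
    Real.summable_nat_rpow_inv.mpr (by norm_num)
  have hS₃₂0 : 0 ≤ S₃₂ := by rw [hS₃₂]; exact tsum_nonneg fun l => by positivity
  refine ⟨(8 * Real.exp 1 ^ 2 * K * E₀ + 3 * majorantConst 0 1 * E₀ + 2 * S₃₂) / Real.pi, 8,
    fun D _ χ hD _ _ => ?_⟩
  intro j hj l₁ hl₁ _ hT
  -- the parameters at `D ≥ 8`
  have hD3 : 3 ≤ D := le_trans (by norm_num) hD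
  obtain ⟨hℓ1, hαeq, hαℓπ, hα0⟩ := params_of_three_le hD3
  have hℓ2 : 2 ≤ ell D := two_le_ell hD
  obtain ⟨L, hL⟩ : ∃ L : ℝ, L = ell D ^ 9 := ⟨_, rfl⟩
  have hL512 : 512 ≤ L := by
    rw [hL]
    calc (512 : ℝ) = 2 ^ 9 := by norm_num
      _ ≤ ell D ^ 9 := pow_le_pow_left₀ (by norm_num) hℓ2 9
  have hL1 : 1 ≤ L := by linarith
  have hL0 : 0 < L := by linarith
  obtain ⟨P, hPdef⟩ : ∃ P : ℝ, P = bigP D := ⟨_, rfl⟩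
  have hlogP' : Real.log P = L := by rw [hPdef, bigP, Real.log_exp, hL]
  have hP1 : 1 < P := by rw [hPdef, bigP]; exact Real.one_lt_exp_iff.mpr (by positivity)
  have hP0 : 0 < P := by linarith
  obtain ⟨Λ, hΛ⟩ : ∃ Λ : ℝ, Λ = ell D ^ 30 := ⟨_, rfl⟩
  have hΛ9 : 9 ≤ Λ := by
    rw [hΛ]
    calc (9 : ℝ) ≤ 2 ^ 30 := by norm_num
      _ ≤ ell D ^ 30 := pow_le_pow_left₀ (by norm_num) hℓ2 30
  have hΛ0 : 0 < Λ := by linarith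
  have hΛL : L ≤ Λ := by rw [hL, hΛ]; exact pow_le_pow_right₀ hℓ1 (by norm_num)
  have hα : alpha D = Real.pi / L := by rw [hαeq, hL]
  have hαα1 : alpha D ≤ alpha1 D := by
    calc alpha D = alpha D * 1 := (mul_one _).symm
      _ ≤ alpha D * ell D := mul_le_mul_of_nonneg_left hℓ1 hα0
      _ ≤ alpha1 D := alpha_mul_ell_le_alpha1 hD3
  -- `β_j = iv`, `|v| ≤ 3πM₀/L`
  obtain ⟨v, hv, hvle⟩ := betaJ_eq_ofReal_mul_I c' D j
  have hv' : |v| ≤ 3 * Real.pi * M₀ / L := by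
    calc |v| ≤ 3 * alpha D * (1 + 5 * |c'| * alpha D * ell D) := hvle
      _ ≤ 3 * alpha D * M₀ := by
          refine mul_le_mul_of_nonneg_left ?_ (by positivity)
          rw [hM₀]
          have : 5 * |c'| * alpha D * ell D = 5 * |c'| * (alpha D * ell D) := by ring
          rw [this]
          gcongr
      _ = 3 * Real.pi * M₀ / L := by rw [hα]; ring
  have hl₁0 : (0 : ℝ) < l₁ := by exact_mod_cast hl₁
  have hl₁1 : (1 : ℝ) ≤ l₁ := by exact_mod_cast hl₁
  -- `P₁`, `N = P^{1/2}/l₁`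
  have hP1le : Skeleton.P1 D ≤ P := by
    show bigP D ^ (0.504 : ℝ) ≤ P
    rw [← hPdef]
    calc P ^ (0.504 : ℝ) ≤ P ^ (1 : ℝ) := Real.rpow_le_rpow_of_exponent_le hP1.le (by norm_num)
      _ = P := Real.rpow_one P
  have hsqrt0 : 0 < P ^ (0.5 : ℝ) := Real.rpow_pos_of_pos hP0 _
  have hlogsqrt : Real.log (P ^ (0.5 : ℝ)) = 0.5 * L := by rw [Real.log_rpow hP0, hlogP']
  obtain ⟨N, hN⟩ : ∃ N : ℝ, N = P ^ (0.5 : ℝ) / l₁ := ⟨_, rfl⟩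
  have hN0 : 0 < N := by rw [hN]; exact div_pos hsqrt0 hl₁0
  have hlogl₁ : Real.log l₁ ≤ L / 4 := log_le_of_lt_bigT hL hℓ1 hℓ2 hl₁0 hT
  have he0 : 0 < Real.exp 1 := Real.exp_pos 1
  have he1 : 1 ≤ Real.exp 1 := by linarith [Real.add_one_le_exp (1 : ℝ)]
  have hlogN : Real.log N = 0.5 * L - Real.log l₁ := by
    rw [hN, Real.log_div hsqrt0.ne' hl₁0.ne', hlogsqrt]
  have hlogN4 : L / 4 ≤ Real.log N := by rw [hlogN]; linarith
  have hlogN0 : 0 < Real.log N := by linarith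
  have hNe : Real.exp 1 ≤ N := by rw [← Real.le_log_iff_exp_le hN0]; linarith
  have hlogNle : Real.log N ≤ 0.5 * L := by
    rw [hlogN]; linarith [Real.log_nonneg hl₁1]
  -- the summands, as opaque functions with pointwise equations
  obtain ⟨f, hf, hseries⟩ : ∃ f : ℕ → ℂ, (∀ l, f l = varrhoJ c' D j l / (l : ℂ) *
      ((Skeleton.P1 D / (l₁ * l : ℕ) : ℝ) : ℂ) ^ beta6 D *
      (((1 / 0.504 : ℝ) : ℂ) * ∫ z in (0.5 : ℝ)..0.504,
        ((gW D (bigP D ^ z / (l₁ * l : ℕ)) - gW D (bigP D ^ (0.5 : ℝ) / (l₁ * l : ℕ)) : ℝ) : ℂ))) ∧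
      seriesB13 c' D j l₁ = ∑' l, f l := ⟨_, fun _ => rfl, rfl⟩
  obtain ⟨g, hg⟩ : ∃ g : ℕ → ℂ, ∀ l, g l =
      (if bigP D ^ (1 / 2 : ℝ) / l₁ < (l : ℝ) then vk1 D (l₁ * l) else 0) *
        varrhoJ c' D j l / (l : ℂ) := ⟨_, fun _ => rfl⟩
  have hy_ge : ∀ l : ℕ, (l : ℝ) ≤ ((l₁ * l : ℕ) : ℝ) := by
    intro l
    rw [Nat.cast_mul]
    nlinarith [Nat.cast_nonneg (α := ℝ) l]
  have hg0 : ∀ l ∉ (Finset.Ico 1 ⌈bigP D⌉₊).filter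
      (fun l : ℕ => bigP D ^ (1 / 2 : ℝ) / l₁ < (l : ℝ)), g l = 0 := by
    intro l hl
    rw [hg]
    by_cases hlt : bigP D ^ (1 / 2 : ℝ) / l₁ < (l : ℝ)
    · have hnot : l ∉ Finset.Ico 1 ⌈bigP D⌉₊ := fun h => hl (Finset.mem_filter.mpr ⟨h, hlt⟩)
      rcases Nat.eq_zero_or_pos l with rfl | hlpos
      · simp
      · have hlP : ⌈bigP D⌉₊ ≤ l := by
          rw [Finset.mem_Ico] at hnot; omega
        have hPc : P ≤ ⌈bigP D⌉₊ := by rw [hPdef]; exact Nat.le_ceil _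
        have hPl : P ≤ ((l₁ * l : ℕ) : ℝ) :=
          le_trans (le_trans hPc (by exact_mod_cast hlP)) (hy_ge l)
        have hvk : vk1 D (l₁ * l) = 0 := by
          unfold vk1; rw [if_neg (not_lt.mpr (le_trans hP1le hPl))]
        rw [if_pos hlt, hvk, zero_mul, zero_div]
    · rw [if_neg hlt, zero_mul, zero_div]
  have htail : tailB3 c' D j l₁ = ∑' l, g l := by
    rw [tsum_eq_sum hg0]
    show ∑ l ∈ (Finset.Ico 1 ⌈bigP D⌉₊).filter (fun l : ℕ => bigP D ^ (1 / 2 : ℝ) / l₁ < (l : ℝ)),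
      vk1 D (l₁ * l) * varrhoJ c' D j l / (l : ℂ) = _
    refine Finset.sum_congr rfl fun l hl => ?_
    rw [Finset.mem_filter] at hl
    rw [hg, if_pos hl.2]
  have hg_sum : Summable g := summable_of_ne_finset_zero hg0
  -- the majorant
  obtain ⟨W, hW⟩ : ∃ W : Finset ℕ,
      W = (Finset.Icc 1 ⌊Real.exp 1 * N⌋₊).filter (fun l : ℕ => N / Real.exp 1 < l) := ⟨_, rfl⟩
  obtain ⟨cO, hcO⟩ : ∃ c : ℝ,
      c = (1 / 0.504) * ((1 / 2) * Real.sqrt (π / Λ) / L + 0.002 * rexp (-Λ)) := ⟨_, rfl⟩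
  have hcO0 : 0 ≤ cO := by rw [hcO]; positivity
  obtain ⟨b₁, hb₁⟩ : ∃ b : ℕ → ℝ, ∀ l, b l = if l ∈ W then 2 * (‖rho v l‖ / l) else 0 :=
    ⟨_, fun _ => rfl⟩
  obtain ⟨b₂, hb₂⟩ : ∃ b : ℕ → ℝ, ∀ l, b l =
      if l ∈ Finset.Icc 1 ⌊P⌋₊ then cO * (‖rho v l‖ / l) else 0 := ⟨_, fun _ => rfl⟩
  obtain ⟨b₃, hb₃⟩ : ∃ b : ℕ → ℝ, ∀ l, b l =
      (0.004 / 0.504) * P ^ (-(1 / 2) : ℝ) * ((l : ℝ) ^ (3 / 2 : ℝ))⁻¹ := ⟨_, fun _ => rfl⟩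
  have hb₁s : Summable b₁ := summable_of_ne_finset_zero (s := W) fun l hl => by
    rw [hb₁, if_neg hl]
  have hb₂s : Summable b₂ := summable_of_ne_finset_zero (s := Finset.Icc 1 ⌊P⌋₊) fun l hl => by
    rw [hb₂, if_neg hl]
  have hb₃s : Summable b₃ := by
    have := hS_sum.mul_left ((0.004 / 0.504) * P ^ (-(1 / 2) : ℝ))
    exact this.congr fun l => (hb₃ l).symm
  -- the termwise bound
  have hbound : ∀ l, ‖f l - g l‖ ≤ b₁ l + b₂ l + b₃ l := by
    intro l
    rcases Nat.eq_zero_or_pos l with rfl | hlpos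
    · have hf0 : f 0 = 0 := by rw [hf]; simp
      have hg00 : g 0 = 0 := by rw [hg]; simp
      have h1 : b₁ 0 = 0 := by rw [hb₁, if_neg (by rw [hW]; simp)]
      have h2 : b₂ 0 = 0 := by rw [hb₂, if_neg (by simp)]
      have h3 : b₃ 0 = 0 := by rw [hb₃]; simp [Real.zero_rpow (by norm_num : (3 / 2 : ℝ) ≠ 0)]
      rw [hf0, hg00, sub_zero, norm_zero, h1, h2, h3]; norm_num
    · have h := u013_term_bound c' D j l₁ l v hv hPdef hlogP' hL1 hP1 hΛ hΛ9 hl₁ hlpos hN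
      rw [← hW, ← hcO] at h
      rw [hf, hg, hb₁, hb₂, hb₃]
      exact h
  -- summation
  have hbs : Summable fun l => b₁ l + b₂ l + b₃ l := (hb₁s.add hb₂s).add hb₃s
  have hfg : Summable fun l => f l - g l := Summable.of_norm_bounded hbs hbound
  have hf_sum : Summable f := (hfg.add hg_sum).congr fun l => sub_add_cancel _ _
  have hnorm : ‖tailB3 c' D j l₁ - seriesB13 c' D j l₁‖ ≤ ∑' l, (b₁ l + b₂ l + b₃ l) := by
    rw [norm_sub_rev, hseries, htail, ← hf_sum.tsum_sub hg_sum]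
    exact tsum_of_norm_bounded hbs.hasSum hbound
  have htsum : ∑' l, (b₁ l + b₂ l + b₃ l) =
      2 * ∑ l ∈ W, ‖rho v l‖ / l + cO * ∑ l ∈ Finset.Icc 1 ⌊P⌋₊, ‖rho v l‖ / l +
        (0.004 / 0.504) * P ^ (-(1 / 2) : ℝ) * S₃₂ := by
    rw [(hb₁s.add hb₂s).tsum_add hb₃s, hb₁s.tsum_add hb₂s]
    congr 1
    · congr 1
      · rw [tsum_eq_sum (s := W) (fun l hl => by rw [hb₁, if_neg hl]), Finset.mul_sum]
        exact Finset.sum_congr rfl fun l hl => by rw [hb₁, if_pos hl]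
      · rw [tsum_eq_sum (s := Finset.Icc 1 ⌊P⌋₊) (fun l hl => by rw [hb₂, if_neg hl]),
          Finset.mul_sum]
        exact Finset.sum_congr rfl fun l hl => by rw [hb₂, if_pos hl]
    · rw [hS₃₂, ← tsum_mul_left]
      exact tsum_congr fun l => hb₃ l
  -- the three pieces
  have hexpW : Real.exp (|v| * Real.log (4 * (Real.exp 1 * N))) ≤ E₀ := by
    have heN1 : 1 ≤ Real.exp 1 * N := one_le_mul_of_one_le_of_one_le he1 (le_trans he1 hNe)
    have hlog : Real.log (4 * (Real.exp 1 * N)) ≤ 3 + L := by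
      rw [Real.log_mul (by norm_num) (by positivity), Real.log_mul he0.ne' hN0.ne',
        Real.log_exp]
      linarith [log_four_le_two]
    have hlog0 : 0 ≤ Real.log (4 * (Real.exp 1 * N)) := Real.log_nonneg (by linarith)
    rw [hE₀]; exact exp_weight_le hv' hL1 hM₀0 hlog0 hlog
  have hPe : Real.exp 1 ≤ P := by rw [hPdef, bigP]; exact Real.exp_le_exp.mpr (by linarith)
  have hX2 : 2 ≤ ⌊P⌋₊ := by
    refine Nat.le_floor ?_
    have h1 := Real.exp_one_gt_d9
    push_cast; linarith
  have hexpX : Real.exp (|v| * Real.log (4 * (⌊P⌋₊ : ℕ))) ≤ E₀ := by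
    have hXP : ((⌊P⌋₊ : ℕ) : ℝ) ≤ P := Nat.floor_le hP0.le
    have hX1 : (1 : ℝ) ≤ ((⌊P⌋₊ : ℕ) : ℝ) := by exact_mod_cast (show 1 ≤ ⌊P⌋₊ by omega)
    have hlog : Real.log (4 * (⌊P⌋₊ : ℕ)) ≤ 3 + L := by
      rw [Real.log_mul (by norm_num) (by positivity)]
      have : Real.log ((⌊P⌋₊ : ℕ) : ℝ) ≤ L := by
        rw [← hlogP']; exact Real.log_le_log (by positivity) hXP
      linarith [log_four_le_two]
    have hlog0 : 0 ≤ Real.log (4 * (⌊P⌋₊ : ℕ)) := Real.log_nonneg (by linarith)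
    rw [hE₀]; exact exp_weight_le hv' hL1 hM₀0 hlog0 hlog
  have hpiece1 : 2 * ∑ l ∈ W, ‖rho v l‖ / l ≤ 8 * Real.exp 1 ^ 2 * K * E₀ / L := by
    have h := sum_norm_rho_div_window_le v hNe
    rw [← hW, ← hK] at h
    calc 2 * ∑ l ∈ W, ‖rho v l‖ / l
        ≤ 2 * (Real.exp 1 ^ 2 * K * Real.exp (|v| * Real.log (4 * (Real.exp 1 * N))) /
            Real.log N) := mul_le_mul_of_nonneg_left h (by norm_num)
      _ ≤ 2 * (Real.exp 1 ^ 2 * K * E₀ / (L / 4)) := by gcongr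
      _ = 8 * Real.exp 1 ^ 2 * K * E₀ / L := by field_simp; ring
  have hpiece2 : cO * ∑ l ∈ Finset.Icc 1 ⌊P⌋₊, ‖rho v l‖ / l ≤ 3 * majorantConst 0 1 * E₀ / L := by
    have h := sum_norm_rho_div_le v hX2
    have hcO3 : cO ≤ 3 / L := by rw [hcO]; exact cO_le hL0 (by linarith) hΛL
    calc cO * ∑ l ∈ Finset.Icc 1 ⌊P⌋₊, ‖rho v l‖ / l
        ≤ (3 / L) * (majorantConst 0 1 * Real.exp (|v| * Real.log (4 * (⌊P⌋₊ : ℕ)))) :=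
          mul_le_mul hcO3 h (Finset.sum_nonneg fun l _ => by positivity) (by positivity)
      _ ≤ (3 / L) * (majorantConst 0 1 * E₀) := by gcongr
      _ = 3 * majorantConst 0 1 * E₀ / L := by field_simp
  have hpiece3 : (0.004 / 0.504) * P ^ (-(1 / 2) : ℝ) * S₃₂ ≤ 2 * S₃₂ / L := by
    have hP12 : P ^ (-(1 / 2) : ℝ) ≤ 2 / L := by rw [hPdef]; exact bigP_rpow_neg_half_le hL hL0
    calc (0.004 / 0.504) * P ^ (-(1 / 2) : ℝ) * S₃₂ ≤ 1 * (2 / L) * S₃₂ := by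
          gcongr
          norm_num
      _ = 2 * S₃₂ / L := by ring
  -- assembly
  have hC0 : 0 ≤ (8 * Real.exp 1 ^ 2 * K * E₀ + 3 * majorantConst 0 1 * E₀ + 2 * S₃₂) / Real.pi := by
    positivity
  calc ‖tailB3 c' D j l₁ - seriesB13 c' D j l₁‖ ≤ ∑' l, (b₁ l + b₂ l + b₃ l) := hnorm
    _ = _ := htsum
    _ ≤ 8 * Real.exp 1 ^ 2 * K * E₀ / L + 3 * majorantConst 0 1 * E₀ / L + 2 * S₃₂ / L :=
        add_le_add (add_le_add hpiece1 hpiece2) hpiece3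
    _ = (8 * Real.exp 1 ^ 2 * K * E₀ + 3 * majorantConst 0 1 * E₀ + 2 * S₃₂) / Real.pi *
          alpha D := by
        rw [hα]; field_simp
    _ ≤ (8 * Real.exp 1 ^ 2 * K * E₀ + 3 * majorantConst 0 1 * E₀ + 2 * S₃₂) / Real.pi *
          alpha1 D := mul_le_mul_of_nonneg_left hαα1 hC0

end Literature.NumberTheory.LFunctions.Zhang2022.AppendixBVarrho
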